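import Literature.NumberTheory.Transcendental.RoySmallValueIdealPQ
import Literature.NumberTheory.Transcendental.RoySmallValuePhiNonvanishing
import Literature.NumberTheory.Transcendental.RoySmallValueEstimatesRegularSeqProofs
import Mathlib.RingTheory.Algebraic.Basic
import HarnessLib

/-!
# Roy's small value estimate for `𝔾ₐ × 𝔾ₘ` — the common zeros of two rational forms are algebraic

Topic `Literature/NumberTheory/Transcendental`. Part of the formalisation of the proof of Roy 2013,
Theorem 1.1 (named fact `roy2013_thm_1_1`, `RoySmallValueEstimates.lean`). Source: D. Roy,
*A small value estimate for `𝔾ₐ × 𝔾ₘ`*, Mathematika 59 (2013) 333–363 = arXiv:1301.0663, §6–7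
(pp. 17–18 of the arXiv text):

> [...] any irreducible component `Z` of `W` in `ℙ²_ℚ` has dimension `0` [...] (the points of
> `Z(ℂ)` are conjugate over `ℚ`) [...] the point `α₀` runs through an infinite sequence of points
> of `ℙ²(ℚ̄)` converging to `(1 : γ)` but distinct from `(1 : γ)` (because `(1:γ) ∉ ℙ²(ℚ̄)`).

The paper uses throughout that the common zeros of two coprime forms `P, Q` with RATIONAL
coefficients are algebraic points. We prove this from the Hilbert function of `(P, Q)`
(`RoySmallValueIdealPQ`): the rational forms `uP + vQ` of degree `ν` span, over `ℂ`, the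
degree-`ν` part of `(P, Q) ⊂ ℂ[X]`, whose codimension is `D²`; hence the `D² + 1` rational
monomials `X_k^{ν−j} X_i^{j}` are linearly dependent modulo `(P, Q)` over `ℚ`, giving a nonzero
rational polynomial vanishing at `β_i/β_k` for every common zero `β` with `β_k ≠ 0`
(`isAlgebraic_ratio_of_common_zero`). Everything is proved; no named facts.

## References

* [Roy2013] D. Roy, *A small value estimate for 𝔾ₐ × 𝔾ₘ*, Mathematika 59 (2013), 333–363
  (arXiv:1301.0663), §6 (proof of Proposition 6.4) and §7, Steps 2–3.
-/

noncomputable section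

open MvPolynomial Finset Module

namespace Literature.NumberTheory.Transcendental

namespace Roy2013

/-- Rational ternary polynomials, and their base change to `ℂ`. [cite: Roy2013, §2] -/
abbrev QX : Type := MvPolynomial (Fin 3) ℚ

/-- Base change `ℚ[X] → ℂ[X]`. [cite: Roy2013, §2] -/
abbrev toCX : QX →ₐ[ℚ] CX := MvPolynomial.mapAlgHom (Algebra.ofId ℚ ℂ)

/-- `toCX` is `map (algebraMap ℚ ℂ)`. [folklore] -/
theorem toCX_apply (p : QX) : toCX p = map (algebraMap ℚ ℂ) p := rfl

/-- `toCX` preserves forms. [folklore] -/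
theorem isHomogeneous_toCX {p : QX} {n : ℕ} (hp : p.IsHomogeneous n) : (toCX p).IsHomogeneous n := by
  rw [toCX_apply]
  intro d hd
  rw [coeff_map] at hd
  exact hp (fun h => hd (by rw [h, map_zero]))

/-- Evaluation of a base-changed polynomial. [folklore] -/
theorem eval_toCX (β : Fin 3 → ℂ) (p : QX) : eval β (toCX p) = aeval β p := by
  rw [toCX_apply, eval_map]; rfl

/-! ### Rational relations span the complex ones -/

/-- The degree-`(n+D)` piece of `(P, Q)` over `ℂ` is spanned by the base changes of the rational
`uP + vQ`, `u, v ∈ ℚ[X]_n`. [folklore] -/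
theorem map_sup_map_le_span_image (P Q : QX) (n : ℕ) :
    (homogeneousSubmodule (Fin 3) ℂ n).map (LinearMap.mulLeft ℂ (toCX P)) ⊔
        (homogeneousSubmodule (Fin 3) ℂ n).map (LinearMap.mulLeft ℂ (toCX Q)) ≤
      Submodule.span ℂ (toCX.toLinearMap ''
        (((homogeneousSubmodule (Fin 3) ℚ n).map (LinearMap.mulLeft ℚ P) ⊔
          (homogeneousSubmodule (Fin 3) ℚ n).map (LinearMap.mulLeft ℚ Q) : Submodule ℚ QX) :
            Set QX)) := by
  classical
  have key : ∀ (R : QX), (homogeneousSubmodule (Fin 3) ℚ n).map (LinearMap.mulLeft ℚ R) ≤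
      ((homogeneousSubmodule (Fin 3) ℚ n).map (LinearMap.mulLeft ℚ P) ⊔
        (homogeneousSubmodule (Fin 3) ℚ n).map (LinearMap.mulLeft ℚ Q)) →
      (homogeneousSubmodule (Fin 3) ℂ n).map (LinearMap.mulLeft ℂ (toCX R)) ≤
        Submodule.span ℂ (toCX.toLinearMap ''
          (((homogeneousSubmodule (Fin 3) ℚ n).map (LinearMap.mulLeft ℚ P) ⊔
            (homogeneousSubmodule (Fin 3) ℚ n).map (LinearMap.mulLeft ℚ Q) : Submodule ℚ QX) :
              Set QX)) := by
    intro R hR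
    rintro _ ⟨u, hu, rfl⟩
    rw [LinearMap.mulLeft_apply]
    -- `u` is a `ℂ`-combination of monomials of degree `n`
    have hu' := mem_span_monomials_of_isHomogeneous ((mem_homogeneousSubmodule _ _).mp hu)
    rw [Finsupp.mem_span_image_iff_linearCombination] at hu'
    obtain ⟨l, hl, rfl⟩ := hu'
    rw [Finsupp.linearCombination_apply, Finsupp.sum, Finset.mul_sum]
    refine Submodule.sum_mem _ fun μ hμ => ?_
    rw [mul_smul_comm]
    refine Submodule.smul_mem _ _ (Submodule.subset_span ⟨R * monomial μ (1 : ℚ), ?_, ?_⟩)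
    · refine hR ⟨monomial μ 1, ?_, rfl⟩
      have hdeg : μ.degree = n := degree_of_mem_finsuppAntidiag (hl hμ)
      exact (mem_homogeneousSubmodule _ _).mpr (isHomogeneous_monomial _ hdeg)
    · rw [AlgHom.toLinearMap_apply, map_mul, toCX_apply, toCX_apply, map_monomial, map_one]
  refine sup_le (key P le_sup_left) (key Q le_sup_right)

/-- Hence the complex piece has dimension at most the rational one. [folklore] -/
theorem finrank_map_sup_map_toCX_le (P Q : QX) (n : ℕ) :
    finrank ℂ ↥((homogeneousSubmodule (Fin 3) ℂ n).map (LinearMap.mulLeft ℂ (toCX P)) ⊔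
        (homogeneousSubmodule (Fin 3) ℂ n).map (LinearMap.mulLeft ℂ (toCX Q))) ≤
      finrank ℚ ↥((homogeneousSubmodule (Fin 3) ℚ n).map (LinearMap.mulLeft ℚ P) ⊔
        (homogeneousSubmodule (Fin 3) ℚ n).map (LinearMap.mulLeft ℚ Q)) := by
  classical
  set Wq : Submodule ℚ QX := (homogeneousSubmodule (Fin 3) ℚ n).map (LinearMap.mulLeft ℚ P) ⊔
    (homogeneousSubmodule (Fin 3) ℚ n).map (LinearMap.mulLeft ℚ Q) with hWq
  haveI : FiniteDimensional ℚ (homogeneousSubmodule (Fin 3) ℚ n) :=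
    NguyenRoy.finiteDimensional_homogeneousSubmodule n
  haveI : FiniteDimensional ℚ ((homogeneousSubmodule (Fin 3) ℚ n).map (LinearMap.mulLeft ℚ P)) :=
    Module.Finite.map _ _
  haveI : FiniteDimensional ℚ ((homogeneousSubmodule (Fin 3) ℚ n).map (LinearMap.mulLeft ℚ Q)) :=
    Module.Finite.map _ _
  haveI : FiniteDimensional ℚ Wq := Submodule.finiteDimensional_sup _ _
  -- a `ℚ`-basis of `Wq` maps to a `ℂ`-spanning family
  let b := Module.finBasis ℚ Wq
  have hspan : (homogeneousSubmodule (Fin 3) ℂ n).map (LinearMap.mulLeft ℂ (toCX P)) ⊔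
      (homogeneousSubmodule (Fin 3) ℂ n).map (LinearMap.mulLeft ℂ (toCX Q)) ≤
      Submodule.span ℂ (Set.range fun i => toCX (b i : QX)) := by
    refine (map_sup_map_le_span_image P Q n).trans (Submodule.span_le.mpr ?_)
    rintro _ ⟨w, hw, rfl⟩
    -- `w = ∑ cᵢ bᵢ`
    have hw' : (⟨w, hw⟩ : Wq) = ∑ i, b.repr ⟨w, hw⟩ i • b i := (b.sum_repr ⟨w, hw⟩).symm
    have hw'' : w = ∑ i, b.repr ⟨w, hw⟩ i • (b i : QX) := by
      conv_lhs => rw [show w = ((⟨w, hw⟩ : Wq) : QX) from rfl, hw']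
      rw [Submodule.coe_sum]
      exact Finset.sum_congr rfl fun i _ => by rw [Submodule.coe_smul]
    rw [AlgHom.toLinearMap_apply, hw'', map_sum]
    refine Submodule.sum_mem _ fun i _ => ?_
    rw [map_smul, ← IsScalarTower.algebraMap_smul ℂ (b.repr ⟨w, hw⟩ i) (toCX (b i : QX))]
    exact Submodule.smul_mem _ _ (Submodule.subset_span ⟨i, rfl⟩)
  haveI : FiniteDimensional ℂ (Submodule.span ℂ (Set.range fun i => toCX (b i : QX))) :=
    FiniteDimensional.span_of_finite ℂ (Set.finite_range _)
  calc finrank ℂ ↥((homogeneousSubmodule (Fin 3) ℂ n).map (LinearMap.mulLeft ℂ (toCX P)) ⊔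
        (homogeneousSubmodule (Fin 3) ℂ n).map (LinearMap.mulLeft ℂ (toCX Q)))
      ≤ finrank ℂ ↥(Submodule.span ℂ (Set.range fun i => toCX (b i : QX))) :=
        Submodule.finrank_mono hspan
    _ ≤ Fintype.card (Fin (finrank ℚ Wq)) := finrank_range_le_card _
    _ = finrank ℚ Wq := Fintype.card_fin _

/-! ### A rational relation among monomials, and algebraicity -/

/-- **A nonzero rational form of the shape `∑_j c_j X_k^{ν−j} X_i^{j}` (`j ≤ D²`) lies in
`(P, Q)`** for coprime rational forms `P, Q` of degree `D ≥ 1` (dimension count over `ℚ`).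
[cite: Roy2013, §6, proof of Proposition 6.4 (zero-dimensionality of `𝒵(P,Q)`); elementary] -/
theorem exists_rational_relation {P Q : QX} {D : ℕ} (hP : P.IsHomogeneous D)
    (hQ : Q.IsHomogeneous D) (hP0 : toCX P ≠ 0) (hQ0 : toCX Q ≠ 0)
    (hPQ : ∀ f : CX, toCX Q * f ∈ Ideal.span {toCX P} → f ∈ Ideal.span {toCX P})
    (k i : Fin 3) (hki : k ≠ i) :
    ∃ c : Fin (D ^ 2 + 1) → ℚ, c ≠ 0 ∧
      toCX (∑ j : Fin (D ^ 2 + 1), c j • (X k ^ (D ^ 2 + 2 * D - j) * X i ^ (j : ℕ))) ∈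
        Ideal.span {toCX P, toCX Q} := by
  classical
  set n : ℕ := D ^ 2 + D with hn
  set ν : ℕ := D ^ 2 + 2 * D with hν
  set Wq : Submodule ℚ QX := (homogeneousSubmodule (Fin 3) ℚ n).map (LinearMap.mulLeft ℚ P) ⊔
    (homogeneousSubmodule (Fin 3) ℚ n).map (LinearMap.mulLeft ℚ Q) with hWq
  set Sν : Submodule ℚ QX := homogeneousSubmodule (Fin 3) ℚ ν with hSν
  haveI : FiniteDimensional ℚ Sν := NguyenRoy.finiteDimensional_homogeneousSubmodule ν
  -- dimensions
  have hdimC := finrank_map_sup_map_add_sq (isHomogeneous_toCX hP) (isHomogeneous_toCX hQ) hP0 hQ0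
    hPQ (D ^ 2)
  rw [show D ^ 2 + D = n by rfl, show D ^ 2 + 2 * D + 2 = ν + 2 by rw [hν]] at hdimC
  have hle := finrank_map_sup_map_toCX_le P Q n
  rw [← hWq] at hle
  have hSdim : finrank ℚ Sν = (ν + 2).choose 2 := NguyenRoy.finrank_homogeneousSubmodule_eq_choose ν
  have hWS : Wq ≤ Sν := by
    refine sup_le ?_ ?_ <;> rintro _ ⟨u, hu, rfl⟩ <;> rw [LinearMap.mulLeft_apply]
    · have h := hP.mul ((mem_homogeneousSubmodule _ _).mp hu)
      rw [show D + n = ν by rw [hn, hν]; ring] at h; exact (mem_homogeneousSubmodule _ _).mpr h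
    · have h := hQ.mul ((mem_homogeneousSubmodule _ _).mp hu)
      rw [show D + n = ν by rw [hn, hν]; ring] at h; exact (mem_homogeneousSubmodule _ _).mpr h
  -- the monomials `g_j = X_k^{ν-j} X_i^j`
  set g : Fin (D ^ 2 + 1) → QX := fun j => X k ^ (ν - j) * X i ^ (j : ℕ) with hg
  have hgmon : ∀ j : Fin (D ^ 2 + 1), g j =
      monomial (Finsupp.single k (ν - j) + Finsupp.single i (j : ℕ)) 1 := by
    intro j
    rw [hg]; dsimp only
    rw [X_pow_eq_monomial, X_pow_eq_monomial, monomial_mul, mul_one]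
  have hgS : ∀ j, g j ∈ Sν := by
    intro j
    rw [hgmon]
    refine (mem_homogeneousSubmodule _ _).mpr (isHomogeneous_monomial _ ?_)
    rw [map_add, Finsupp.degree_single, Finsupp.degree_single]
    have := j.2; omega
  have hginj : Function.Injective fun j : Fin (D ^ 2 + 1) =>
      Finsupp.single k (ν - (j : ℕ)) + Finsupp.single i (j : ℕ) := by
    intro j₁ j₂ h
    have h' := congrArg (fun f => f i) h
    simp only [Finsupp.coe_add, Pi.add_apply, Finsupp.single_apply, if_neg hki,
      zero_add] at h'
    exact Fin.ext h'
  have hgli : LinearIndependent ℚ g := by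
    have h := (MvPolynomial.basisMonomials (Fin 3) ℚ).linearIndependent
    rw [coe_basisMonomials] at h
    rw [show g = (fun s : Fin 3 →₀ ℕ => monomial s (1 : ℚ)) ∘
      (fun j : Fin (D ^ 2 + 1) => Finsupp.single k (ν - (j : ℕ)) + Finsupp.single i (j : ℕ)) from
      funext hgmon]
    exact h.comp _ hginj
  set G : Submodule ℚ QX := Submodule.span ℚ (Set.range g) with hG
  have hGS : G ≤ Sν := Submodule.span_le.mpr (by rintro _ ⟨j, rfl⟩; exact hgS j)
  have hGdim : finrank ℚ G = D ^ 2 + 1 := by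
    rw [hG, finrank_span_eq_card hgli, Fintype.card_fin]
  haveI : FiniteDimensional ℚ G := Submodule.finiteDimensional_of_le hGS
  haveI : FiniteDimensional ℚ Wq := Submodule.finiteDimensional_of_le hWS
  -- `G ⊓ Wq ≠ ⊥` by counting dimensions
  have hinf : G ⊓ Wq ≠ ⊥ := by
    intro hbot
    have h1 := Submodule.finrank_sup_add_finrank_inf_eq G Wq
    rw [hbot, finrank_bot, add_zero, hGdim] at h1
    have h2 : finrank ℚ ↥(G ⊔ Wq) ≤ finrank ℚ Sν := Submodule.finrank_mono (sup_le hGS hWS)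
    rw [hSdim] at h2
    omega
  obtain ⟨f, hf, hf0⟩ := (Submodule.ne_bot_iff _).mp hinf
  obtain ⟨hfG, hfW⟩ := Submodule.mem_inf.mp hf
  rw [hG, Finsupp.mem_span_range_iff_exists_finsupp] at hfG
  obtain ⟨l, rfl⟩ := hfG
  refine ⟨fun j => l j, ?_, ?_⟩
  · intro h0
    apply hf0
    rw [Finsupp.sum]
    exact Finset.sum_eq_zero fun j _ => by rw [show l j = 0 from congr_fun h0 j, zero_smul]
  · -- membership in `(P, Q)` after base change
    have hsum : (∑ j : Fin (D ^ 2 + 1), l j • (X k ^ (D ^ 2 + 2 * D - (j : ℕ)) * X i ^ (j : ℕ)) : QX) =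
        l.sum fun j c => c • g j := by
      rw [Finsupp.sum_fintype _ _ (fun j => by rw [zero_smul])]
    rw [hsum]
    obtain ⟨_, ⟨u, hu, rfl⟩, _, ⟨v, hv, rfl⟩, huv⟩ := Submodule.mem_sup.mp hfW
    rw [← huv, LinearMap.mulLeft_apply, LinearMap.mulLeft_apply, map_add, map_mul, map_mul]
    exact Ideal.add_mem _ (Ideal.mul_mem_right _ _ (Ideal.subset_span (by simp)))
      (Ideal.mul_mem_right _ _ (Ideal.subset_span (by simp)))

/-- **The common zeros of two coprime rational ternary forms are algebraic points**: for a common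
zero `β` of `P, Q` (rational forms of degree `D`, coprime over `ℂ`) and a coordinate `β_k ≠ 0`,
every ratio `β_i / β_k` is algebraic over `ℚ`. [cite: Roy2013, §7, Step 2 ("`α₀ ∈ ℙ²(ℚ̄)`") and
§6, proof of Proposition 6.4] -/
theorem isAlgebraic_ratio_of_common_zero {P Q : QX} {D : ℕ} (hP : P.IsHomogeneous D)
    (hQ : Q.IsHomogeneous D) (hP0 : toCX P ≠ 0) (hQ0 : toCX Q ≠ 0)
    (hPQ : ∀ f : CX, toCX Q * f ∈ Ideal.span {toCX P} → f ∈ Ideal.span {toCX P})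
    {β : Fin 3 → ℂ} (hβP : eval β (toCX P) = 0) (hβQ : eval β (toCX Q) = 0) {k : Fin 3}
    (hβk : β k ≠ 0) (i : Fin 3) : IsAlgebraic ℚ (β i / β k) := by
  classical
  by_cases hki : k = i
  · rw [← hki, div_self hβk]; exact isAlgebraic_one
  obtain ⟨c, hc0, hmem⟩ := exists_rational_relation hP hQ hP0 hQ0 hPQ k i hki
  -- evaluate the relation at `β`
  have hval : eval β (toCX (∑ j : Fin (D ^ 2 + 1),
      c j • (X k ^ (D ^ 2 + 2 * D - (j : ℕ)) * X i ^ (j : ℕ)))) = 0 := by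
    obtain ⟨a, b, hab⟩ := Ideal.mem_span_pair.mp hmem
    rw [← hab, map_add, map_mul, map_mul, hβP, hβQ, mul_zero, mul_zero, add_zero]
  rw [eval_toCX, map_sum] at hval
  simp only [map_smul, map_mul, map_pow, aeval_X] at hval
  -- the univariate polynomial `p = ∑ c_j t^j`
  set p : Polynomial ℚ := ∑ j : Fin (D ^ 2 + 1), Polynomial.C (c j) * Polynomial.X ^ (j : ℕ) with hp
  have hp0 : p ≠ 0 := by
    intro h0
    apply hc0
    funext j
    have hj := congrArg (Polynomial.coeff · (j : ℕ)) h0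
    simp only [hp, Polynomial.finsetSum_coeff, Polynomial.coeff_C_mul_X_pow,
      Polynomial.coeff_zero] at hj
    rw [Finset.sum_eq_single j (fun j' _ hj' => if_neg (fun h => hj' (Fin.ext h).symm))
      (fun h => absurd (mem_univ j) h), if_pos rfl] at hj
    exact hj
  refine ⟨p, hp0, ?_⟩
  -- `p(β_i/β_k) = β_k^{-ν} · (∑ c_j β_k^{ν-j} β_i^j) = 0`
  have hν : ∀ j : Fin (D ^ 2 + 1), (j : ℕ) ≤ D ^ 2 + 2 * D := fun j => by have := j.2; omega
  rw [hp, map_sum]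
  simp only [map_mul, Polynomial.aeval_C, map_pow, Polynomial.aeval_X]
  have key : ∑ j : Fin (D ^ 2 + 1), algebraMap ℚ ℂ (c j) * (β i / β k) ^ (j : ℕ) =
      (β k ^ (D ^ 2 + 2 * D))⁻¹ *
        ∑ j : Fin (D ^ 2 + 1), c j • (β k ^ (D ^ 2 + 2 * D - (j : ℕ)) * β i ^ (j : ℕ)) := by
    rw [Finset.mul_sum]
    refine Finset.sum_congr rfl fun j _ => ?_
    rw [Algebra.smul_def, div_pow]
    have h1 : β k ^ (D ^ 2 + 2 * D) = β k ^ (D ^ 2 + 2 * D - (j : ℕ)) * β k ^ (j : ℕ) := by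
      rw [← pow_add, Nat.sub_add_cancel (hν j)]
    rw [h1]
    field_simp
  rw [key, hval, mul_zero]

end Roy2013

end Literature.NumberTheory.Transcendental
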